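import Summits.HubbardSuperconductivity.HubbardSuperconductivity.Theses.LevyLogBootstrap
import Summits.HubbardSuperconductivity.HubbardSuperconductivity.Theorems.LevyLogBootstrapBlock2InfDivXXZKernelCovariance
import Literature.MathematicalPhysics.QuantumLattice.LiebMattisLadder
import HarnessLib

/-!
# Crux `LevyTransport` (stmt-HubbardSuperconductivity-15049, route `LevyLogBootstrap`), line `birth`:
# 2×2 blocks of the even torus and the block row sum of a translation-invariant kernel

Helper for `stub_levyFloor` of `Cruxes/LevyTransport/Lines/birth.lean` (block size 2, block
membership written exactly as inside `Block2InfDivXXZ`: `∀ i, (x' i).val / 2 = (x i).val / 2`):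

* `LevyFloor.card_filter_block` — every 2×2 block of `(ℤ/M)²`, `M` even, has exactly four sites;
  `sum_ite_block`, `sum_ite_block_zero` — the corresponding indicator sums;
* `LevyFloor.sum_row_eq`, `sum_sum_eq` — for a translation-invariant kernel `K` on the torus every
  row sum is `Σ_u K(u,0)` and the total sum is `M² Σ_u K(u,0)`;
* `LevyFloor.sum_blockKernel_zero` (registered `∀`-form `blockRowSum_all`) — the BLOCK ROW SUM
  `Σ_x K₂(block x, block 0) = 16 Σ_u K(u,0)`;
* `LevyFloor.blockKernel_zero_zero_ge` — `K₂(0,0) ≥ 4δ` if `K ≥ 0` and `K(x,x) = δ`.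

Elementary counting on `ZMod M` (`ZMod.val_injective`, `Fintype.card_piFinset`); no definition;
sorry-free. [folklore]
-/

noncomputable section

set_option linter.dupNamespace false

namespace Summit.HubbardSuperconductivity.HubbardSuperconductivity.Theorems.LevyLogBootstrap

open scoped BigOperators Matrix ComplexOrder
open Matrix Finset Complex
open Literature.MathematicalPhysics.QuantumLattice Literature.Probability.LatticeModels
open Summit.AtomisticToContinuum.BoseEinsteinCondensation.Theorems.BECStronglyRayleighSectorPerron
open Summit.AtomisticToContinuum.BoseEinsteinCondensation.Theorems.InsertionFieldDelocalisation.Negative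
open Summit.HubbardSuperconductivity.HubbardSuperconductivity.Theorems.PolyaSchurPairBoson

namespace LevyFloor

section Blocks

variable (M : ℕ) [NeZero M]

/-- Block indices `⌊z/2⌋` of residues `z ∈ ℤ/M` (`M` even) are `< M/2`. [folklore] -/
theorem val_div_two_lt_half (hM : Even M) (z : ZMod M) : z.val / 2 < M / 2 := by
  obtain ⟨N, hN⟩ := hM
  have := z.val_lt
  omega

/-- For even `M` and `q < M/2` exactly two residues `z ∈ ℤ/M` have block index `⌊z/2⌋ = q`,
namely `2q` and `2q + 1`. [folklore] -/
theorem card_filter_val_div_two (hM : Even M) (q : ℕ) (hq : q < M / 2) :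
    (Finset.univ.filter (fun z : ZMod M => z.val / 2 = q)).card = 2 := by
  obtain ⟨N, hN⟩ := hM
  have h2q : 2 * q + 1 < M := by omega
  have hval0 : ((2 * q : ℕ) : ZMod M).val = 2 * q := ZMod.val_natCast_of_lt (by omega)
  have hval1 : ((2 * q + 1 : ℕ) : ZMod M).val = 2 * q + 1 := ZMod.val_natCast_of_lt h2q
  have hset : Finset.univ.filter (fun z : ZMod M => z.val / 2 = q) =
      {((2 * q : ℕ) : ZMod M), ((2 * q + 1 : ℕ) : ZMod M)} := by
    ext z
    simp only [Finset.mem_filter, Finset.mem_univ, true_and, Finset.mem_insert,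
      Finset.mem_singleton]
    constructor
    · intro hz
      have hzv : z.val = 2 * q ∨ z.val = 2 * q + 1 := by omega
      rcases hzv with h | h
      · left
        apply ZMod.val_injective M
        rw [hval0, h]
      · right
        apply ZMod.val_injective M
        rw [hval1, h]
    · rintro (rfl | rfl)
      · rw [hval0]; omega
      · rw [hval1]; omega
  rw [hset, Finset.card_pair]
  intro h
  have := congrArg ZMod.val h
  rw [hval0, hval1] at this
  omega

/-- Every 2×2 block of the even torus `(ℤ/M)²` has exactly four sites. [folklore] -/
theorem card_filter_block (hM : Even M) (q : Fin 2 → ℕ) (hq : ∀ i, q i < M / 2) :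
    (Finset.univ.filter (fun x : TorusSite 2 M => ∀ i, (x i).val / 2 = q i)).card = 4 := by
  have hset : Finset.univ.filter (fun x : TorusSite 2 M => ∀ i, (x i).val / 2 = q i) =
      Fintype.piFinset (fun i => Finset.univ.filter (fun z : ZMod M => z.val / 2 = q i)) := by
    ext x
    simp only [Finset.mem_filter, Finset.mem_univ, true_and, Fintype.mem_piFinset]
  rw [hset, Fintype.card_piFinset]
  simp_rw [card_filter_val_div_two M hM _ (hq _)]
  simp

/-- Summing a constant over the block of a site `b`: `Σ_x [x ∈ block(b)] t = 4t` (block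
membership written as inside `Block2InfDivXXZ`: `∀ i, (b i).val / 2 = (x i).val / 2`). [folklore] -/
theorem sum_ite_block (hM : Even M) (b : TorusSite 2 M) (t : ℝ) :
    ∑ x : TorusSite 2 M, (if (∀ i : Fin 2, (b i).val / 2 = (x i).val / 2) then t else 0) =
      4 * t := by
  rw [Finset.sum_ite, Finset.sum_const_zero, add_zero, Finset.sum_const, nsmul_eq_mul]
  have hflt : (Finset.univ.filter fun x : TorusSite 2 M => ∀ i : Fin 2, (b i).val / 2 = (x i).val / 2)
      = Finset.univ.filter fun x : TorusSite 2 M => ∀ i : Fin 2, (x i).val / 2 = (b i).val / 2 := by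
    refine Finset.filter_congr fun x _ => ?_
    exact forall_congr' fun i => eq_comm
  rw [hflt, card_filter_block M hM (fun i => (b i).val / 2) (fun i => val_div_two_lt_half M hM (b i))]
  norm_num

/-- Summing a constant over the block of the origin, membership written against the term
`(0 : TorusSite 2 M)` as it arises by unfolding `blockKernel M ψ x 0`: `Σ_y [y ∈ block(0)] t = 4t`.
[folklore] -/
theorem sum_ite_block_zero (hM : Even M) (t : ℝ) :
    ∑ y : TorusSite 2 M,
        (if (∀ i : Fin 2, (y i).val / 2 = ((0 : TorusSite 2 M) i).val / 2) then t else 0) =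
      4 * t := by
  have h := sum_ite_block M hM (0 : TorusSite 2 M) t
  have hflt : ∀ y : TorusSite 2 M, (∀ i : Fin 2, (y i).val / 2 = ((0 : TorusSite 2 M) i).val / 2) ↔
      (∀ i : Fin 2, ((0 : TorusSite 2 M) i).val / 2 = (y i).val / 2) :=
    fun y => forall_congr' fun i => eq_comm
  simp_rw [hflt]
  exact h

end Blocks

/-! ### Translation-invariant kernels on the torus: sums -/

section Kernel

variable {M : ℕ} [NeZero M] (K : TorusSite 2 M → TorusSite 2 M → ℝ)

/-- For a translation-invariant kernel every row sum is the row sum at the origin: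
`Σ_{x'} K(x', y') = Σ_u K(u, 0)`. [folklore] -/
theorem sum_row_eq (hT : ∀ v x y : TorusSite 2 M, K (x + v) (y + v) = K x y) (y' : TorusSite 2 M) :
    ∑ x' : TorusSite 2 M, K x' y' = ∑ u : TorusSite 2 M, K u 0 := by
  have hsub : ∀ x' : TorusSite 2 M, K x' y' = K (x' - y') 0 := by
    intro x'
    have h := hT (-y') x' y'
    rw [add_neg_cancel, ← sub_eq_add_neg] at h
    exact h.symm
  simp_rw [hsub]
  exact Fintype.sum_equiv (Equiv.subRight y') _ _ (fun _ => rfl)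

/-- Total sum of a translation-invariant kernel: `Σ_{x,y} K(x,y) = M² · Σ_u K(u,0)`. [folklore] -/
theorem sum_sum_eq (hT : ∀ v x y : TorusSite 2 M, K (x + v) (y + v) = K x y) :
    ∑ x : TorusSite 2 M, ∑ y : TorusSite 2 M, K x y = (M : ℝ) ^ 2 * ∑ u : TorusSite 2 M, K u 0 := by
  rw [Finset.sum_comm]
  simp_rw [sum_row_eq K hT]
  rw [Finset.sum_const, Finset.card_univ, card_torusSite, nsmul_eq_mul]
  push_cast
  ring

/-- Pulling an `x`-independent condition out of an `x`-sum. [folklore] -/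
theorem sum_ite_const_cond {ι : Type*} (s : Finset ι) (c : Prop) [Decidable c] (f : ι → ℝ) :
    ∑ x ∈ s, (if c then f x else 0) = if c then ∑ x ∈ s, f x else 0 := by
  by_cases hc : c <;> simp [hc]

/-- **Block row sum.** For a translation-invariant kernel on the even torus, the sum over all
sites `x` of the 2×2-block kernel `K₂(block x, block 0)` equals `16 · Σ_u K(u, 0)` (every site
lies in the block of exactly four sites; block `0` has four sites). [folklore] -/
theorem sum_blockKernel_zero (hM : Even M)
    (hT : ∀ v x y : TorusSite 2 M, K (x + v) (y + v) = K x y) :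
    ∑ x : TorusSite 2 M, ∑ x' : TorusSite 2 M, ∑ y' : TorusSite 2 M,
        (if (∀ i : Fin 2, (x' i).val / 2 = (x i).val / 2) ∧
            (∀ i : Fin 2, (y' i).val / 2 = ((0 : TorusSite 2 M) i).val / 2) then K x' y' else 0) =
      16 * ∑ u : TorusSite 2 M, K u 0 := by
  -- split the conjunction, block-`0` condition outside
  have hsplit : ∀ x x' y' : TorusSite 2 M,
      (if (∀ i : Fin 2, (x' i).val / 2 = (x i).val / 2) ∧
          (∀ i : Fin 2, (y' i).val / 2 = ((0 : TorusSite 2 M) i).val / 2) then K x' y' else 0) =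
      (if (∀ i : Fin 2, (y' i).val / 2 = ((0 : TorusSite 2 M) i).val / 2) then
        (if (∀ i : Fin 2, (x' i).val / 2 = (x i).val / 2) then K x' y' else 0) else 0) := by
    intro x x' y'
    by_cases h1 : (∀ i : Fin 2, (x' i).val / 2 = (x i).val / 2) <;>
      by_cases h2 : (∀ i : Fin 2, (y' i).val / 2 = ((0 : TorusSite 2 M) i).val / 2) <;>
      simp [h1, h2]
  simp_rw [hsplit]
  -- `x`-sum innermost: `Σ_x Σ_{x'} Σ_{y'} = Σ_{x'} Σ_{y'} Σ_x`
  rw [Finset.sum_comm]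
  have hx : ∀ x' : TorusSite 2 M,
      ∑ x : TorusSite 2 M, ∑ y' : TorusSite 2 M,
        (if (∀ i : Fin 2, (y' i).val / 2 = ((0 : TorusSite 2 M) i).val / 2) then
          (if (∀ i : Fin 2, (x' i).val / 2 = (x i).val / 2) then K x' y' else 0) else 0) =
      ∑ y' : TorusSite 2 M,
        (if (∀ i : Fin 2, (y' i).val / 2 = ((0 : TorusSite 2 M) i).val / 2) then
          4 * K x' y' else 0) := by
    intro x'
    rw [Finset.sum_comm]
    refine Finset.sum_congr rfl fun y' _ => ?_
    rw [sum_ite_const_cond, sum_ite_block M hM x' (K x' y')]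
  simp_rw [hx]
  -- `x'`-sum inside the block-`0` condition, then the row sum
  rw [Finset.sum_comm]
  have hy : ∀ y' : TorusSite 2 M,
      ∑ x' : TorusSite 2 M,
        (if (∀ i : Fin 2, (y' i).val / 2 = ((0 : TorusSite 2 M) i).val / 2) then
          4 * K x' y' else 0) =
      (if (∀ i : Fin 2, (y' i).val / 2 = ((0 : TorusSite 2 M) i).val / 2) then
          4 * ∑ u : TorusSite 2 M, K u 0 else 0) := by
    intro y'
    rw [sum_ite_const_cond, ← Finset.mul_sum, sum_row_eq K hT y']
  simp_rw [hy]
  rw [sum_ite_block_zero M hM]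
  ring

/-- **Diagonal block bound.** If `K ≥ 0` entrywise and `K(x, x) = δ` for all `x`, then the
block kernel at the origin block satisfies `K₂(0, 0) ≥ 4δ` (keep only the four diagonal terms).
[folklore] -/
theorem blockKernel_zero_zero_ge (hM : Even M) (hK0 : ∀ x y, 0 ≤ K x y) {δ : ℝ}
    (hdiag : ∀ x, K x x = δ) :
    4 * δ ≤ ∑ x' : TorusSite 2 M, ∑ y' : TorusSite 2 M,
        (if (∀ i : Fin 2, (x' i).val / 2 = ((0 : TorusSite 2 M) i).val / 2) ∧
            (∀ i : Fin 2, (y' i).val / 2 = ((0 : TorusSite 2 M) i).val / 2) then K x' y' else 0) := by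
  have hterm : ∀ x' y' : TorusSite 2 M, 0 ≤
      (if (∀ i : Fin 2, (x' i).val / 2 = ((0 : TorusSite 2 M) i).val / 2) ∧
          (∀ i : Fin 2, (y' i).val / 2 = ((0 : TorusSite 2 M) i).val / 2) then K x' y' else 0) := by
    intro x' y'
    split_ifs
    · exact hK0 x' y'
    · exact le_rfl
  -- keep the diagonal term of each inner sum
  have hinner : ∀ x' : TorusSite 2 M,
      (if (∀ i : Fin 2, (x' i).val / 2 = ((0 : TorusSite 2 M) i).val / 2) then δ else 0) ≤
      ∑ y' : TorusSite 2 M,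
        (if (∀ i : Fin 2, (x' i).val / 2 = ((0 : TorusSite 2 M) i).val / 2) ∧
            (∀ i : Fin 2, (y' i).val / 2 = ((0 : TorusSite 2 M) i).val / 2) then K x' y' else 0) := by
    intro x'
    refine le_trans ?_ (Finset.single_le_sum (fun y' _ => hterm x' y') (Finset.mem_univ x'))
    by_cases h : (∀ i : Fin 2, (x' i).val / 2 = ((0 : TorusSite 2 M) i).val / 2)
    · rw [if_pos h, if_pos ⟨h, h⟩, hdiag]
    · rw [if_neg h, if_neg (fun hh => h hh.1)]
  refine le_trans ?_ (Finset.sum_le_sum fun x' _ => hinner x')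
  rw [sum_ite_block_zero M hM]

end Kernel

end LevyFloor

open LevyFloor in
/-- **Registered sub-goal `blockRowSum_all` (crux `LevyTransport`)**: the `∀`-closed form of
`LevyFloor.sum_blockKernel_zero` — for every translation-invariant real kernel `K` on the even
torus `(ℤ/M)²`, `Σ_x Σ_{x' ∈ block x} Σ_{y' ∈ block 0} K(x', y') = 16 Σ_u K(u, 0)`. [folklore] -/
theorem blockRowSum_all :
    ∀ (M : ℕ) [NeZero M], Even M → ∀ K : TorusSite 2 M → TorusSite 2 M → ℝ,
      (∀ v x y : TorusSite 2 M, K (x + v) (y + v) = K x y) →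
      ∑ x : TorusSite 2 M, ∑ x' : TorusSite 2 M, ∑ y' : TorusSite 2 M,
          (if (∀ i : Fin 2, (x' i).val / 2 = (x i).val / 2) ∧
              (∀ i : Fin 2, (y' i).val / 2 = ((0 : TorusSite 2 M) i).val / 2) then K x' y' else 0) =
        16 * ∑ u : TorusSite 2 M, K u 0 :=
  fun _ _ hM K hT => sum_blockKernel_zero K hM hT

end Summit.HubbardSuperconductivity.HubbardSuperconductivity.Theorems.LevyLogBootstrap

end
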